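import Literature.NumberTheory.GelbartRogawski1991.LocalUnitarySplittingDatum
import Literature.RepresentationTheory.HeisenbergGroup.SchrodingerUnramifiedVector
import Literature.NumberTheory.Automorphic.GlobalAdditiveCharacterProofs
import Literature.NumberTheory.Automorphic.AdicCompletionLocalField
import HarnessLib

/-!
# Implementers of a RATIONAL symplectic matrix fix the line of `1_{𝒪_vᴺ}` at almost every place

[Weil1964, Chap. III n° 37–38 p. 188–190] (the local factors `𝐫_v(γ)` of a rational `γ ∈ Sp(X)_k` map the standard function
`1_{𝒪_v}` to itself for almost all `v`); [MoeglinVignerasWaldspurger1987, Chap. 2 II.10]; [GelbartRogawski1991, §3.1 (3.1.3)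
p. 456]. The representation-theoretic core is the tree's `SchrodingerUnramifiedVector` (every implementer of an INTEGRAL
symplectic matrix has `1_{𝒪^ι}` as an eigenvector, for `ψ` of conductor `𝒪` and `2 ∈ 𝒪^×`); this file supplies the
number-field bookkeeping:

* §1 the rational symplectic matrix `γ ∈ Sp_{2N}(F)` at a finite place: `ratSpLoc v γ = transportSp (T ⊗ F_v) (γ ⊗ 1) ∈ Sp(𝕎_v)`
  (the local symplectic group of `LocalUnitarySplittingDatum`, Gram matrix a rational `T ∈ GL_N(F)`);
* §2 for almost all `v` the entries of `γ` are `v`-integral (`eventually_forall_entry_mem`), and then `γ ⊗ 1` is the image of a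
  symplectic matrix over `𝒪_v` (`integralLift`, `mapHom_subtype_integralLift`); `⅟2 ∈ 𝒪_v` for almost all `v`;
  `1_{𝒪_vᴺ} = unitVec` is the indicator of `piPrimePowBall _ _ 0`;
* §3 **`eventually_exists_smul_unitVec`**: if the local smooth Schrödinger models have implementers unique up to scalars
  (`hU v`, [MoeglinVignerasWaldspurger1987, Chap. 2 II.2]), then for almost all `v` EVERY implementer `M` of `ratSpLoc v γ`
  satisfies `M 1_{𝒪_vᴺ} = c • 1_{𝒪_vᴺ}`, `c ∈ ℂˣ`.

Kernel mathematics only; no Prop record, no named fact, no `sorry`.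
-/

set_option autoImplicit false

noncomputable section

open scoped Matrix Classical
open NumberField IsDedekindDomain Filter MeasureTheory
open Literature.RepresentationTheory.HeisenbergGroup
open Literature.NumberTheory.Automorphic

namespace Literature.NumberTheory.GelbartRogawski1991.UnitaryDualPair.LocalSplitting

variable (F : Type) [Field F] [NumberField F] (N : ℕ) (T : Matrix (Fin N) (Fin N) F) (hTd : IsUnit T.det)

/-! ## §1 The rational symplectic matrix at a finite place -/

include hTd in
/-- `det (T ⊗ 1) ∈ 𝔸_F^×`. [cite: Weil1964, Chap. III n° 37 p. 188] -/
theorem isUnit_det_gramAdele : IsUnit (T.map (algebraMap F (AdeleRing (𝓞 F) F))).det :=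
  UnitaryGroup.isUnit_det_map _ hTd

include hTd in
/-- `det (T ⊗ F_v) ∈ F_v^×`. [cite: Weil1964, Chap. III n° 37 p. 188] -/
theorem isUnit_det_localGram (v : HeightOneSpectrum (𝓞 F)) : IsUnit (localGram F N T v).det :=
  UnitaryGroup.isUnit_det_map _ hTd

/-- **`γ ∈ Sp_{2N}(F)` at the place `v`**: `transportSp (T ⊗ F_v) (γ ⊗ 1) ∈ Sp(𝕎_v)` — the rational symplectic matrix in the
local symplectic group of the Gram form `β_{T_v}` (the target of `ι_v`). [cite: Weil1964, Chap. III n° 37 p. 188] -/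
def ratSpLoc (v : HeightOneSpectrum (𝓞 F)) : Matrix.symplecticGroup (Fin N) F →* LocalSp F N T v :=
  (SymplecticMatrix.transportSp (localGram F N T v) (isUnit_det_localGram F N T hTd v)).comp
    (SymplecticMatrix.mapHom (algebraMap F (v.adicCompletion F)))

/-! ## §2 Integrality at almost every place -/

/-- an element of `F` is `v`-integral for almost all `v`. [cite: CasselsFrohlichANT1967, Ch. II §14] -/
theorem eventually_algebraMap_mem_adicCompletionIntegers (x : F) :
    ∀ᶠ v : HeightOneSpectrum (𝓞 F) in cofinite, algebraMap F (v.adicCompletion F) x ∈ v.adicCompletionIntegers F := by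
  by_cases hx : x = 0
  · exact Filter.Eventually.of_forall fun v => by rw [hx, map_zero]; exact zero_mem _
  · exact (UnitaryGroup.eventually_valued_algebraMap_eq_one (E := F) hx).mono fun v hv => by
      rw [HeightOneSpectrum.mem_adicCompletionIntegers, hv]

/-- the entries of a rational matrix are `v`-integral for almost all `v`. [cite: CasselsFrohlichANT1967, Ch. II §14] -/
theorem eventually_forall_entry_mem {m : Type*} [Fintype m] (A : Matrix m m F) :
    ∀ᶠ v : HeightOneSpectrum (𝓞 F) in cofinite, ∀ i j, algebraMap F (v.adicCompletion F) (A i j) ∈ v.adicCompletionIntegers F := by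
  simp only [Filter.eventually_all]
  exact fun i j => eventually_algebraMap_mem_adicCompletionIntegers F (A i j)

/-- `⅟2 ∈ 𝒪_v` for almost all `v`. [cite: CasselsFrohlichANT1967, Ch. II §14] -/
theorem eventually_invOf_two_mem :
    ∀ᶠ v : HeightOneSpectrum (𝓞 F) in cofinite, (⅟(2 : v.adicCompletion F) : v.adicCompletion F) ∈ v.adicCompletionIntegers F :=
  (eventually_algebraMap_mem_adicCompletionIntegers F (2⁻¹ : F)).mono fun v hv => by
    rwa [map_inv₀, map_ofNat, ← invOf_eq_inv] at hv

variable {F N}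

/-- **a `v`-integral rational symplectic matrix as a symplectic matrix over `𝒪_v`**. [cite: Weil1964, Chap. III n° 37 p. 188] -/
def integralLift (v : HeightOneSpectrum (𝓞 F)) (γ : Matrix.symplecticGroup (Fin N) F)
    (hγ : ∀ i j, algebraMap F (v.adicCompletion F) ((γ : Matrix (Fin N ⊕ Fin N) (Fin N ⊕ Fin N) F) i j) ∈
      v.adicCompletionIntegers F) :
    Matrix.symplecticGroup (Fin N) ↥(v.adicCompletionIntegers F) := by
  refine ⟨Matrix.of fun i j => ⟨_, hγ i j⟩, ?_⟩
  have hinj : Function.Injective fun A : Matrix (Fin N ⊕ Fin N) (Fin N ⊕ Fin N) ↥(v.adicCompletionIntegers F) =>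
      A.map (v.adicCompletionIntegers F).subtype :=
    fun A B h => Matrix.ext fun i j => Subtype.ext (congrFun (congrFun h i) j)
  have hA : (Matrix.of fun i j => (⟨_, hγ i j⟩ : ↥(v.adicCompletionIntegers F))).map (v.adicCompletionIntegers F).subtype =
      ((SymplecticMatrix.mapHom (algebraMap F (v.adicCompletion F)) γ : Matrix.symplecticGroup (Fin N) (v.adicCompletion F)) :
        Matrix (Fin N ⊕ Fin N) (Fin N ⊕ Fin N) (v.adicCompletion F)) := by
    rw [SymplecticMatrix.coe_mapHom]; rfl
  have hγv := SymplecticGroup.mem_iff.1 (SymplecticMatrix.mapHom (algebraMap F (v.adicCompletion F)) γ).2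
  rw [SymplecticGroup.mem_iff]
  apply hinj
  change ((Matrix.of fun i j => (⟨_, hγ i j⟩ : ↥(v.adicCompletionIntegers F))) * Matrix.J (Fin N) ↥(v.adicCompletionIntegers F) *
      (Matrix.of fun i j => (⟨_, hγ i j⟩ : ↥(v.adicCompletionIntegers F)))ᵀ).map (v.adicCompletionIntegers F).subtype =
    (Matrix.J (Fin N) ↥(v.adicCompletionIntegers F)).map (v.adicCompletionIntegers F).subtype
  rw [Matrix.map_mul, Matrix.map_mul, Matrix.transpose_map, Matrix.map_J _ (v.adicCompletionIntegers F).subtype, hA]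
  exact hγv

/-- `integralLift γ ⊗ F_v = γ ⊗ F_v`. [cite: Weil1964, Chap. III n° 37 p. 188] -/
theorem mapHom_subtype_integralLift (v : HeightOneSpectrum (𝓞 F)) (γ : Matrix.symplecticGroup (Fin N) F)
    (hγ : ∀ i j, algebraMap F (v.adicCompletion F) ((γ : Matrix (Fin N ⊕ Fin N) (Fin N ⊕ Fin N) F) i j) ∈
      v.adicCompletionIntegers F) :
    SymplecticMatrix.mapHom (v.adicCompletionIntegers F).subtype (integralLift v γ hγ) =
      SymplecticMatrix.mapHom (algebraMap F (v.adicCompletion F)) γ :=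
  Subtype.ext (by rw [SymplecticMatrix.coe_mapHom, SymplecticMatrix.coe_mapHom]; rfl)

variable (F N) in
/-- `1_{𝒪_vᴺ}` is the indicator of the box `piPrimePowBall F_v (Fin N) 0`. [cite: Weil1964, Chap. III n° 37 p. 188] -/
theorem coe_unitVec_eq_indicator_piPrimePowBall (v : HeightOneSpectrum (𝓞 F)) :
    ((unitVec F (Fin N) v : SchwartzBruhat (Fin N → v.adicCompletion F)) : (Fin N → v.adicCompletion F) → ℂ) =
      (piPrimePowBall (v.adicCompletion F) (Fin N) 0).indicator fun _ => (1 : ℂ) := by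
  have hset : integralBox F (Fin N) v = piPrimePowBall (v.adicCompletion F) (Fin N) 0 := by
    ext x
    rw [piPrimePowBall, integralBox, Set.mem_univ_pi, Set.mem_univ_pi]
    exact forall_congr' fun i => (mem_primePowBall_zero_iff (x i)).symm
  rw [coe_unitVec, hset]

/-! ## §3 The eigenvector property at almost every place -/

variable (F N) in
include hTd in
/-- **for almost all `v`, every implementer of a rational symplectic matrix has `1_{𝒪_vᴺ}` as an eigenvector**: given
uniqueness of implementers up to scalars on the local smooth Schrödinger models (`hU`), for all but finitely many finite
places `v` of `F`, every `M` implementing `ratSpLoc v γ` on `𝒮(F_vᴺ)` satisfies `M 1_{𝒪_vᴺ} = c • 1_{𝒪_vᴺ}` with `c ∈ ℂˣ`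
(off the places where `γ` is not integral, `2 ∉ 𝒪_v^×`, or `ψ_v` is ramified).
[cite: Weil1964, Chap. III n° 38 p. 190; MoeglinVignerasWaldspurger1987, Chap. 2 II.10] -/
theorem eventually_exists_smul_unitVec (γ : Matrix.symplecticGroup (Fin N) F)
    (hU : ∀ v : HeightOneSpectrum (𝓞 F), ImplementerUniqueUpToScalar (localSchrodinger F N T v)) :
    ∀ᶠ v : HeightOneSpectrum (𝓞 F) in cofinite,
      ∀ M : SchwartzBruhat (Fin N → v.adicCompletion F) ≃ₗ[ℂ] SchwartzBruhat (Fin N → v.adicCompletion F),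
        Implements (localSchrodinger F N T v) (ofSymplectic _ (ratSpLoc F N T hTd v γ)) M →
          ∃ c : ℂˣ, M (unitVec F (Fin N) v) = (c : ℂ) • unitVec F (Fin N) v := by
  filter_upwards [eventually_forall_entry_mem F (γ : Matrix (Fin N ⊕ Fin N) (Fin N ⊕ Fin N) F),
    eventually_invOf_two_mem F, eventually_hasConductorExp_zero_adicComponent_adeleAddChar (K := F)] with v hγ h2 hcond
  intro M hM
  letI : MeasurableSpace (v.adicCompletion F) := borel _
  haveI : BorelSpace (v.adicCompletion F) := ⟨rfl⟩
  have hb : ∀ y : Fin N → v.adicCompletion F, Continuous fun u : Fin N → v.adicCompletion F =>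
      dotProductBilin (v.adicCompletion F) (v.adicCompletion F) u y := fun y => by
    simp only [dotProductBilin_apply_apply, dotProduct]
    exact continuous_finsetSum _ fun i _ => (continuous_apply i).mul continuous_const
  have hbT : ∀ y : Fin N → v.adicCompletion F, Continuous fun u : Fin N → v.adicCompletion F =>
      localPairing F N T v u y := fun y => by
    simp only [Matrix.toLinearMap₂'_apply', dotProduct]
    exact continuous_finsetSum _ fun i _ => (continuous_apply i).mul continuous_const
  have himp : Implements (localSchrodinger F N T v) (ofSymplectic _
      (SymplecticMatrix.transportSp (localGram F N T v) (isUnit_det_localGram F N T hTd v)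
        (SymplecticMatrix.mapHom (v.adicCompletionIntegers F).subtype (integralLift v γ hγ)))) M := by
    rw [mapHom_subtype_integralLift]; exact hM
  exact exists_smul_integersIndicator_of_implements (localGram F N T v) (isUnit_det_localGram F N T hTd v)
    (isLocallyConstant_of_isContinuousNontrivial (isContinuousNontrivial_adeleAddCharAt F v)) hbT
    (v.adicCompletionIntegers F).subtype (fun r => (mem_primePowBall_zero_iff (r : v.adicCompletion F)).2 r.2)
    (unitVec F (Fin N) v) (coe_unitVec_eq_indicator_piPrimePowBall F N v) hb Measure.addHaar
    (isContinuousNontrivial_adeleAddCharAt F v) hcond ((mem_primePowBall_zero_iff _).2 h2) (hU v)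
    (integralLift v γ hγ) himp

end Literature.NumberTheory.GelbartRogawski1991.UnitaryDualPair.LocalSplitting

end
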